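import Literature.NumberTheory.Sieve.SmoothParityMajorArcsFlat
import Literature.NumberTheory.Sieve.SmoothParityMinorArcsFlat
import HarnessLib

/-!
# Parity-class friable ternary counts: the zeroth-order circle method, explicit form

Topic `Literature/NumberTheory/Sieve`, namespace `Literature.NumberTheory.Sieve.SmoothArcs`; a PROVED assembly file
([Harper2016, §5], [LagariasSoundararajan2012, Thm 1.3]).  The circle split `parity_circle_split`, the flat major arcs
`parity_major_arcs_flat` and the flat minor arcs `parity_minor_arcs_flat` are combined into ONE explicit inequality for the
weighted count `parityTernarySum y σ d₁ d₂ (x/e₁) (x/e₂) (x/e₃) c₁ c₂ c₃` of `y`-friable solutions of `d₁n₁ + σd₂n₂ = n₃`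
(`n₁, n₂` odd) against its main term `𝔖 · parityModelCount`:

`parityTernary_explicit`: with `Mv_i = e_i^{−α}𝓜` (`α = α(x,y)`, `𝓜 = x^αζ(α,y)/√(2πφ₂(α,y))`), the sample modulus
`N₀ = d₁d₂(⌊x/(d₁d₂)⌋ + 1) + 1` chosen HERE (`x < N₀ ≤ 2x`, `N₀ ≡ 1 (mod d₁)`, `(mod d₂)`), the major points
`‖r/N₀ − a/k‖ ≤ 96R/x` (`k ≤ R`, `(k,a) = 1`, `a < k`) and their complement (minor at `(R/e₃, R/x)` by
`minor_of_forall_coprime`):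
`‖parityTernarySum − 𝔖·parityModelCount‖ ≤ (Mv₁Mv₂Mv₃/X₃) · (F + C (log x)^{24} e_B s^{1/2})`
with the scalar major-arc error `F` of `SmoothParityMajorArcsFlat` and the scalar minor-arc error `s` of
`SmoothParityMinorArcsFlat` (all parameters `R, Λ, η, E, ε₀, C_F, P, H, G₀, Φ, Δ, W, e_B, D` explicit hypotheses; no
limit is taken here — that is `SmoothParityAsymptotic`).

## References

* A. J. Harper, Compositio Math. 152 (2016), §5 [Harper2016].
* J. C. Lagarias, K. Soundararajan, Proc. LMS 104 (2012), Thm 1.3 [LagariasSoundararajan2012].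
-/

noncomputable section

open Finset Real Complex
open scoped FourierTransform

namespace Literature.NumberTheory.Sieve

namespace SmoothArcs

open TwistedWeight Vinogradov
open scoped Classical

/-! ### The sample modulus and the minor property of the complement of the major points -/

/-- The sample modulus `N₀ = d₁d₂(⌊x/(d₁d₂)⌋ + 1) + 1`: `x < N₀ ≤ x + d₁d₂ + 1`, coprime to `d₁` and to `d₂`. [folklore] -/
theorem sampleModulus_spec {x : ℝ} (hx : 0 ≤ x) {d₁ d₂ : ℕ} (hd₁ : 1 ≤ d₁) (hd₂ : 1 ≤ d₂) :
    x < ((d₁ * d₂ * (⌊x / (d₁ * d₂)⌋₊ + 1) + 1 : ℕ) : ℝ) ∧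
      ((d₁ * d₂ * (⌊x / (d₁ * d₂)⌋₊ + 1) + 1 : ℕ) : ℝ) ≤ x + d₁ * d₂ + 1 ∧
      Nat.Coprime d₁ (d₁ * d₂ * (⌊x / (d₁ * d₂)⌋₊ + 1) + 1) ∧ Nat.Coprime d₂ (d₁ * d₂ * (⌊x / (d₁ * d₂)⌋₊ + 1) + 1) := by
  have hdd : (0 : ℝ) < (d₁ : ℝ) * d₂ := by
    have h1 : (1 : ℝ) ≤ d₁ := by exact_mod_cast hd₁
    have h2 : (1 : ℝ) ≤ d₂ := by exact_mod_cast hd₂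
    positivity
  have hfl := Nat.lt_floor_add_one (x / (d₁ * d₂))
  have hfl' := Nat.floor_le (div_nonneg hx hdd.le)
  have hxe : x = (d₁ : ℝ) * d₂ * (x / (d₁ * d₂)) := by field_simp
  refine ⟨?_, ?_, ?_, ?_⟩
  · push_cast
    nlinarith
  · push_cast
    have h1 : (d₁ : ℝ) * d₂ * (⌊x / (d₁ * d₂)⌋₊ : ℝ) ≤ (d₁ : ℝ) * d₂ * (x / (d₁ * d₂)) :=
      mul_le_mul_of_nonneg_left hfl' hdd.le
    rw [← hxe] at h1
    linarith
  · rw [Nat.coprime_comm, show d₁ * d₂ * (⌊x / (d₁ * d₂)⌋₊ + 1) + 1 = 1 + d₁ * (d₂ * (⌊x / (d₁ * d₂)⌋₊ + 1)) by ring,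
      Nat.coprime_add_mul_left_left]
    exact Nat.coprime_one_left d₁
  · rw [Nat.coprime_comm, show d₁ * d₂ * (⌊x / (d₁ * d₂)⌋₊ + 1) + 1 = 1 + d₂ * (d₁ * (⌊x / (d₁ * d₂)⌋₊ + 1)) by ring,
      Nat.coprime_add_mul_left_left]
    exact Nat.coprime_one_left d₂

/-- The complement of the major points is minor: if `r < N₀` is not within `ρ = 96R/x` (in `‖·‖`) of any reduced `a/k`,
`k ≤ R`, `a < k`, and `ρR < 1`, then `|r/N₀ − a/q| > ρ` for all `1 ≤ q ≤ R`, `a ∈ ℤ` (`minor_of_forall_coprime`; the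
fraction `1/1` is covered by `‖r/N₀‖ ≤ |r/N₀ − 1|`). [folklore] -/
theorem minor_of_not_major {N₀ R r : ℕ} {ρ : ℝ} (hN : 0 < N₀) (hr : r < N₀) (hρ : ρ * R < 1)
    (h : ¬ ∃ k : ℕ, 1 ≤ k ∧ k ≤ R ∧ ∃ a : ℕ, a < k ∧ Nat.Coprime k a ∧ distInt ((r : ℝ) / N₀ - (a : ℝ) / k) ≤ ρ) :
    ∀ q : ℕ, 1 ≤ q → (q : ℝ) ≤ R → ∀ a : ℤ, ρ < |(r : ℝ) / N₀ - a / q| := by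
  push Not at h
  have hN0 : (0 : ℝ) < N₀ := by exact_mod_cast hN
  refine minor_of_forall_coprime (by positivity) ((div_lt_one hN0).2 (by exact_mod_cast hr)) hρ ?_
  intro k hk1 hkR a hak hcop
  rcases lt_or_eq_of_le hak with hlt | rfl
  · exact lt_of_lt_of_le (h k hk1 hkR a hlt hcop.symm) (distInt_le_abs_sub_int _ 0 |>.trans_eq (by simp))
  · -- `a = k`: coprimality forces `k = 1`; use the reduced fraction `0/1`
    have hk : a = 1 := by simpa using hcop
    subst hk
    have h1 := h 1 le_rfl hkR 0 zero_lt_one (Nat.coprime_one_left 0)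
    refine lt_of_lt_of_le h1 ?_
    simpa using distInt_le_abs_sub_int ((r : ℝ) / N₀) 1

/-! ### The explicit zeroth-order inequality -/

set_option maxHeartbeats 1600000 in
/-- **THE ZEROTH-ORDER CIRCLE METHOD FOR PARITY-CLASS FRIABLE TERNARY COUNTS, explicit form.**  See the module docstring:
under the master-scale range facts, the regime at the three scales `x/e_i` and at `2x/e₃`, the arc parameters
`R, Λ, η, E, ε₀, C_F` with the window hypothesis (hW) and the character-sum currency (hF), and the uniform bounds
`P, H, G₀, Φ, Δ, W, e_B, D`:
`‖parityTernarySum − 𝔖·parityModelCount‖ ≤ (Mv₁Mv₂Mv₃/X₃)(F + C(log x)^{24}e_B s^{1/2})`.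
[cite: Harper2016, §5] [cite: LagariasSoundararajan2012, Thm 1.3 (shape)] -/
theorem parityTernary_explicit :
    ∃ C x₀ : ℝ, 0 < C ∧ ∀ (x : ℝ) (y : ℕ) (e₁ e₂ e₃ d₁ d₂ : ℕ) (σ : ℤ) (eB D : ℝ),
      x₀ ≤ x → Real.log x ^ 4 ≤ (y : ℝ) → Real.log (y : ℝ) ≤ Real.log x ^ (1 / 5 : ℝ) →
      13 / 15 < saddlePoint x y → saddlePoint x y ≤ 1 → 1 - 1 / 10000 ≤ saddlePoint x y →
      (σ = 1 ∨ σ = -1) → 1 ≤ e₁ → 1 ≤ e₂ → 1 ≤ e₃ → (e₁ : ℝ) ≤ eB → (e₂ : ℝ) ≤ eB → (e₃ : ℝ) ≤ eB →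
      eB ≤ x ^ (1 / 2 : ℝ) → 1 ≤ d₁ → 1 ≤ d₂ → Even d₁ → Odd d₂ → (d₁ : ℝ) ≤ D → (d₂ : ℝ) ≤ D → D ^ 2 + 1 ≤ x →
      (d₁ : ℝ) / e₁ + d₂ / e₂ + 1 / e₃ ≤ 1 →
      x₀ ≤ x / e₁ → Real.log (x / e₁) ^ 8 ≤ (y : ℝ) → Real.log (y : ℝ) ≤ 1 / 2 * Real.log (x / e₁) ^ (1 / 6 : ℝ) →
      (y : ℝ) ^ 200 ≤ x / e₁ → 1 - 1 / 10000 ≤ saddlePoint (x / e₁) y →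
      (x / e₁) ^ ((39999 : ℝ) / 40000) ≤ ((Nat.smoothNumbersUpTo ⌊x / e₁⌋₊ (y + 1)).card : ℝ) →
      x₀ ≤ x / e₂ → Real.log (x / e₂) ^ 8 ≤ (y : ℝ) → Real.log (y : ℝ) ≤ 1 / 2 * Real.log (x / e₂) ^ (1 / 6 : ℝ) →
      (y : ℝ) ^ 200 ≤ x / e₂ → 1 - 1 / 10000 ≤ saddlePoint (x / e₂) y →
      (x / e₂) ^ ((39999 : ℝ) / 40000) ≤ ((Nat.smoothNumbersUpTo ⌊x / e₂⌋₊ (y + 1)).card : ℝ) →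
      x₀ ≤ x / e₃ → Real.log (x / e₃) ^ 8 ≤ (y : ℝ) → Real.log (y : ℝ) ≤ 1 / 2 * Real.log (x / e₃) ^ (1 / 6 : ℝ) →
      (y : ℝ) ^ 200 ≤ x / e₃ → 1 - 1 / 10000 ≤ saddlePoint (x / e₃) y →
      (x / e₃) ^ ((39999 : ℝ) / 40000) ≤ ((Nat.smoothNumbersUpTo ⌊x / e₃⌋₊ (y + 1)).card : ℝ) →
      Real.log (2 * (x / e₃)) ^ 8 ≤ (y : ℝ) → 1 - 1 / 10000 ≤ saddlePoint (2 * (x / e₃)) y → ⌈Real.exp 107⌉₊ ≤ y →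
      ∀ (R : ℕ) (Λ η E ε₀ C_F : ℝ), 2 ≤ R → R ≤ y → 400 * (R : ℝ) ^ 3 < x → (R : ℝ) ≤ x ^ (1 / 10 : ℝ) → eB ≤ R →
      192 * (R : ℝ) ≤ Λ → Λ ≤ x / eB → 0 ≤ η → η ≤ 1 → 0 < ε₀ → 0 ≤ C_F →
      (∀ e' : ℕ, 1 ≤ e' → (e' : ℝ) ≤ E → ∀ lam : ℝ, |lam| ≤ Λ →
        ‖(∑ n ∈ Nat.smoothNumbersUpTo ⌊x / e'⌋₊ (y + 1), twistWeight lam (n / (x / e'))) -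
            (((e' : ℝ) ^ (-saddlePoint x y) * (x ^ saddlePoint x y * smoothZeta (saddlePoint x y) y /
            Real.sqrt (2 * Real.pi * saddlePhi₂ (saddlePoint x y) y)) : ℝ) : ℂ) * twistMellin lam (saddlePoint x y)‖ ≤
          (e' : ℝ) ^ (-saddlePoint x y) * (η * (x ^ saddlePoint x y * smoothZeta (saddlePoint x y) y /
            Real.sqrt (2 * Real.pi * saddlePhi₂ (saddlePoint x y) y)) / (1 + |lam|))) →
      (∀ (q : ℕ) (χ : DirichletCharacter ℂ q), q ≠ 0 → χ ≠ 1 → ∀ (y : ℕ) (X lam : ℝ), 1 ≤ X →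
        ‖∑ n ∈ Nat.smoothNumbersUpTo ⌊X⌋₊ (y + 1), χ (n : ZMod q) * twistWeight lam (n / X)‖ ≤
          C_F * (1 + |lam|) ^ 3 * X ^ (1 / 2 + ε₀) * (q : ℝ) ^ ε₀) →
      ((e₁ * (2 * R) ^ 2 : ℕ) : ℝ) ≤ E → ((e₂ * (2 * R) ^ 2 : ℕ) : ℝ) ≤ E → ((e₃ * R ^ 2 : ℕ) : ℝ) ≤ E →
      ∀ (c₁ c₂ c₃ : ℤ → ℂ), Summable (fun ℓ : ℤ => ‖c₁ ℓ‖ * (1 + |(ℓ : ℝ)|) ^ 3) →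
      Summable (fun ℓ : ℤ => ‖c₂ ℓ‖ * (1 + |(ℓ : ℝ)|) ^ 3) → Summable (fun ℓ : ℤ => ‖c₃ ℓ‖ * (1 + |(ℓ : ℝ)|) ^ 3) →
      (∀ v : ℝ, ‖profileFn c₁ v‖ ≤ 1) → (∀ v : ℝ, ‖profileFn c₂ v‖ ≤ 1) → (∀ v : ℝ, ‖profileFn c₃ v‖ ≤ 1) →
      ∀ (P : ℝ), profileNorm c₁ ≤ P → profileNorm c₂ ≤ P → profileNorm c₃ ≤ P →
      ∀ (H : ℝ), (∑ k ∈ Icc 1 R, ∑ a ∈ (Finset.range k).filter (Nat.Coprime k),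
        classLocalHc (saddlePoint x y) 2 1 k (d₁ * a) * classLocalHc (saddlePoint x y) 2 1 k (σ * (d₂ * a)) *
          classLocalHc (saddlePoint x y) 1 0 k a ≤ H) →
      ∀ (G₀ : ℝ), 0 < G₀ → G₀ ≤ (x ^ saddlePoint x y * smoothZeta (saddlePoint x y) y /
            Real.sqrt (2 * Real.pi * saddlePhi₂ (saddlePoint x y) y)) →
      ∀ (Φ : ℝ), saddlePhi₂ (saddlePoint x y) y ≤ Φ →
      ∀ (Δ W : ℝ), 12 * (1 + Λ) * P * eB / x + 16 * P / Λ ^ 3 ≤ Δ → Δ ≤ 1 →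
      2 * R * C_F * x ^ (1 / 2 + ε₀) * (2 * R : ℝ) ^ ε₀ * (1 + Λ) ^ 3 * P * eB / G₀ +
        16 * Real.sqrt (2 * Real.pi * Φ) * P / Λ ^ 3 ≤ W → W ≤ 1 →
        ‖parityTernarySum y σ d₁ d₂ (x / e₁) (x / e₂) (x / e₃) c₁ c₂ c₃ -
            paritySingSeries (saddlePoint x y) σ d₁ d₂ *
              parityModelCount σ d₁ d₂ (x / e₁) (x / e₂) (x / e₃) ((e₁ : ℝ) ^ (-saddlePoint x y) * (x ^ saddlePoint x y * smoothZeta (saddlePoint x y) y /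
            Real.sqrt (2 * Real.pi * saddlePhi₂ (saddlePoint x y) y)))
                ((e₂ : ℝ) ^ (-saddlePoint x y) * (x ^ saddlePoint x y * smoothZeta (saddlePoint x y) y /
            Real.sqrt (2 * Real.pi * saddlePhi₂ (saddlePoint x y) y)))
                ((e₃ : ℝ) ^ (-saddlePoint x y) * (x ^ saddlePoint x y * smoothZeta (saddlePoint x y) y /
            Real.sqrt (2 * Real.pi * saddlePhi₂ (saddlePoint x y) y))) (saddlePoint x y) c₁ c₂ c₃‖ ≤
          ((e₁ : ℝ) ^ (-saddlePoint x y) * (x ^ saddlePoint x y * smoothZeta (saddlePoint x y) y /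
            Real.sqrt (2 * Real.pi * saddlePhi₂ (saddlePoint x y) y))) *
            ((e₂ : ℝ) ^ (-saddlePoint x y) * (x ^ saddlePoint x y * smoothZeta (saddlePoint x y) y /
            Real.sqrt (2 * Real.pi * saddlePhi₂ (saddlePoint x y) y))) *
            ((e₃ : ℝ) ^ (-saddlePoint x y) * (x ^ saddlePoint x y * smoothZeta (saddlePoint x y) y /
            Real.sqrt (2 * Real.pi * saddlePhi₂ (saddlePoint x y) y))) / (x / e₃) *
            ((P ^ 3 * H * (331 * η * (28 + 16 * Real.log (2 * eB)) +
                100 * (eB / (3 * R) + 8 * D * (1 + 2 * eB * (1 + Real.log (2 * x))) / x)) +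
              2316 * R * (3 * (11 * P + 1) ^ 2 * Δ * H + 375 * (11 * P + 2) ^ 2 * W * (R : ℝ) ^ 8) +
              48 * D ^ 2 * P ^ 3 * ((R : ℝ) + 1) ^ (-(1 / 6 : ℝ))) +
              C * Real.log x ^ 24 * eB *
                (P * (C * Real.log (2 * x) ^ 3 * (y : ℝ) ^ (1 / 4000 : ℝ) * ((R : ℝ) / eB) ^ (-(9 / 20 : ℝ)) *
                    (2 * Real.sqrt 5 * Real.sqrt (2 * Real.pi * Φ)) +
                  (164 * (1 + Real.log (2 * x)) ^ 2 * (y : ℝ) ^ 2 * (2 * x) ^ (9 / 10 : ℝ) + 1) * eB / G₀ +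
                  64 * Real.sqrt (2 * Real.pi * Φ) / ((R : ℝ) / eB) ^ 2) +
                8 * Real.sqrt (2 * Real.pi * Φ) * P / ((R : ℝ) / eB) ^ 3) ^ (1 / 2 : ℝ)) := by
  obtain ⟨C, x_m, hC, hMIN⟩ := parity_minor_arcs_flat
  refine ⟨C, max x_m (Real.exp 2), hC, ?_⟩
  intro x y e₁ e₂ e₃ d₁ d₂ σ eB D hx hy4 hylog hα hα1 hα4 hσ he₁ he₂ he₃ heB₁ heB₂ heB₃ heBx hd₁1 hd₂1 hd₁e hd₂o hd₁D hd₂D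
    hDx hde hx₁ hy8₁ hy6₁ hy200₁ hα₁ hΨ₁ hx₂ hy8₂ hy6₂ hy200₂ hα₂ hΨ₂ hx₃ hy8₃ hy6₃ hy200₃ hα₃ hΨ₃ hy8₃' hα' hy107
    R Λ η E ε₀ C_F hR2 hRy hRx hRx10 heBR hΛR hΛx hη0 hη1 hε₀ hCF hW hF hE₁ hE₂ hE₃ c₁ c₂ c₃ hc₁ hc₂ hc₃ hp₁ hp₂ hp₃
    P hP₁ hP₂ hP₃ H hH G₀ hG₀ hGM Φ hΦ Δ W hΔ hΔ1 hWW hW1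
  rw [max_le_iff] at hx hx₁ hx₂ hx₃
  -- ### basic ranges
  have hxe : Real.exp 2 ≤ x := hx.2
  have hx1 : 1 < x := lt_of_lt_of_le (by have := Real.add_one_le_exp (2 : ℝ); linarith) hxe
  have hx0 : 0 < x := by linarith
  have hL2 : 2 ≤ Real.log x := by rw [Real.le_log_iff_exp_le hx0]; exact hxe
  have hy2 : 2 ≤ y := by
    have h16 : (2 : ℝ) ^ 4 ≤ Real.log x ^ 4 := pow_le_pow_left₀ zero_le_two hL2 4
    have : (2 : ℝ) ≤ y := by norm_num at h16; linarith
    exact_mod_cast this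
  obtain ⟨he₁0, he₂0, he₃0⟩ : (0 : ℝ) < e₁ ∧ (0 : ℝ) < e₂ ∧ (0 : ℝ) < e₃ :=
    ⟨by exact_mod_cast he₁, by exact_mod_cast he₂, by exact_mod_cast he₃⟩
  obtain ⟨he₁1, he₂1, he₃1⟩ : (1 : ℝ) ≤ e₁ ∧ (1 : ℝ) ≤ e₂ ∧ (1 : ℝ) ≤ e₃ :=
    ⟨by exact_mod_cast he₁, by exact_mod_cast he₂, by exact_mod_cast he₃⟩
  have heB1 : 1 ≤ eB := he₁1.trans heB₁
  have heB0 : 0 < eB := by linarith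
  have hsqrt_le : x ^ (1 / 2 : ℝ) ≤ x := by
    calc x ^ (1 / 2 : ℝ) ≤ x ^ (1 : ℝ) := Real.rpow_le_rpow_of_exponent_le hx1.le (by norm_num)
      _ = x := Real.rpow_one x
  have heBx' : eB ≤ x := heBx.trans hsqrt_le
  have hR1 : (1 : ℝ) ≤ R := by exact_mod_cast (by omega : 1 ≤ R)
  have hR0 : (0 : ℝ) < R := by linarith
  have hΛ0 : 0 < Λ := by linarith
  have hΛe : ∀ {e : ℕ}, 1 ≤ e → (e : ℝ) ≤ eB → Λ ≤ x / e := fun he heB =>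
    hΛx.trans (div_le_div_of_nonneg_left hx0.le (by exact_mod_cast (show 0 < _ by omega)) heB)
  -- `d_i/e_i ≤ 1`
  have hfrac : (d₁ : ℝ) / e₁ ≤ 1 ∧ (d₂ : ℝ) / e₂ ≤ 1 := by
    have h1 : 0 ≤ (d₁ : ℝ) / e₁ := by positivity
    have h2 : 0 ≤ (d₂ : ℝ) / e₂ := by positivity
    have h3 : 0 ≤ (1 : ℝ) / e₃ := by positivity
    exact ⟨by linarith, by linarith⟩
  have hd₁ : (d₁ : ℝ) * (x / e₁) ≤ x := by
    rw [mul_div_assoc', div_le_iff₀ he₁0, mul_comm]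
    exact mul_le_mul_of_nonneg_left ((div_le_one he₁0).1 hfrac.1) hx0.le
  have hd₂ : (d₂ : ℝ) * (x / e₂) ≤ x := by
    rw [mul_div_assoc', div_le_iff₀ he₂0, mul_comm]
    exact mul_le_mul_of_nonneg_left ((div_le_one he₂0).1 hfrac.2) hx0.le
  -- ### the sample modulus
  obtain ⟨hxN, hNx, hcop₁, hcop₂⟩ := sampleModulus_spec hx0.le hd₁1 hd₂1
  set N₀ : ℕ := d₁ * d₂ * (⌊x / (d₁ * d₂)⌋₊ + 1) + 1 with hN₀def
  clear_value N₀
  have hN0 : (0 : ℝ) < N₀ := by linarith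
  have hN1 : 1 ≤ N₀ := by exact_mod_cast (show (0 : ℝ) < N₀ from hN0)
  have hdd : (d₁ : ℝ) * d₂ ≤ D ^ 2 := by
    calc (d₁ : ℝ) * d₂ ≤ D * D := mul_le_mul hd₁D hd₂D (Nat.cast_nonneg _) (le_trans (Nat.cast_nonneg _) hd₁D)
      _ = D ^ 2 := by ring
  have hN2 : (N₀ : ℝ) ≤ 2 * x := by linarith
  have hN : (d₁ : ℝ) * (x / e₁) + (d₂ : ℝ) * (x / e₂) + x / e₃ < N₀ := by
    have : (d₁ : ℝ) * (x / e₁) + (d₂ : ℝ) * (x / e₂) + x / e₃ = x * ((d₁ : ℝ) / e₁ + d₂ / e₂ + 1 / e₃) := by ring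
    rw [this]
    exact lt_of_le_of_lt (mul_le_of_le_one_right hx0.le hde) hxN
  have hxRN : x ≤ 96 * R * N₀ := hxN.le.trans (le_mul_of_one_le_left hN0.le (by linarith))
  have hIc₁ : IsCoprime (d₁ : ℤ) N₀ := Nat.isCoprime_iff_coprime.2 hcop₁
  have hIc₂ : IsCoprime (d₂ : ℤ) N₀ := Nat.isCoprime_iff_coprime.2 hcop₂
  -- ### the major arcs
  have hMAJ := parity_major_arcs_flat hx1 hy2 hα hα1 hα4 hΛ0 hη0 hη1 hε₀ hCF hW hF hσ he₁ he₂ he₃ heB₁ heB₂ heB₃ heBx'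
    (hΛe he₁ heB₁) (hΛe he₂ heB₂) (hΛe he₃ heB₃) hd₁1 hd₂1 hd₁e hd₂o hd₁D hd₂D hd₁ hd₂ hN hcop₁ hxN.le hN2 hR2 hRy hRx
    hxRN hΛR hE₁ hE₂ hE₃ hc₁ hc₂ hc₃ hP₁ hP₂ hP₃ hH hG₀ hGM hΦ hΔ hΔ1 hWW hW1
  -- ### the minor arcs on the complement
  set Maj : Finset ℕ := (Finset.range N₀).filter (fun r : ℕ => ∃ k : ℕ, 1 ≤ k ∧ k ≤ R ∧ ∃ a : ℕ, a < k ∧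
    Nat.Coprime k a ∧ distInt ((r : ℝ) / N₀ - (a : ℝ) / k) ≤ 96 * R / x) with hMajdef
  have hMajsub : Maj ⊆ Finset.range N₀ := Finset.filter_subset _ _
  have hρR : 96 * R / x * R < 1 := by
    rw [div_mul_eq_mul_div, div_lt_one hx0]
    have h1 : (R : ℝ) * R ≤ (R : ℝ) ^ 3 := by
      calc (R : ℝ) * R = (R : ℝ) ^ 2 * 1 := by ring
        _ ≤ (R : ℝ) ^ 2 * R := mul_le_mul_of_nonneg_left hR1 (by positivity)
        _ = (R : ℝ) ^ 3 := by ring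
    calc 96 * (R : ℝ) * R = 96 * ((R : ℝ) * R) := by ring
      _ ≤ 96 * (R : ℝ) ^ 3 := by linarith
      _ < x := by linarith
  have hminor : ∀ r ∈ Finset.range N₀ \ Maj, ∀ q : ℕ, 1 ≤ q → (q : ℝ) ≤ R / e₃ → ∀ a : ℤ,
      R / e₃ / (x / e₃) < |(r : ℝ) / N₀ - a / q| := by
    intro r hr q hq hqR a
    rw [Finset.mem_sdiff, Finset.mem_range] at hr
    have hnot : ¬ ∃ k : ℕ, 1 ≤ k ∧ k ≤ R ∧ ∃ a : ℕ, a < k ∧ Nat.Coprime k a ∧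
        distInt ((r : ℝ) / N₀ - (a : ℝ) / k) ≤ 96 * R / x := by
      intro hex; exact hr.2 (Finset.mem_filter.2 ⟨Finset.mem_range.2 hr.1, hex⟩)
    have h := minor_of_not_major (Nat.pos_of_ne_zero (by omega)) hr.1 hρR hnot q hq
      (hqR.trans (div_le_self hR0.le he₃1)) a
    refine lt_of_le_of_lt ?_ h
    rw [div_div_div_cancel_right₀ he₃0.ne']
    exact div_le_div_of_nonneg_right (by linarith) hx0.le
  have hRe₃ : (R : ℝ) / e₃ ≤ (2 * (x / e₃)) ^ (1 / 10 : ℝ) := by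
    have h1 : (e₃ : ℝ) ^ (1 / 10 : ℝ) ≤ e₃ := by
      calc (e₃ : ℝ) ^ (1 / 10 : ℝ) ≤ (e₃ : ℝ) ^ (1 : ℝ) := Real.rpow_le_rpow_of_exponent_le he₃1 (by norm_num)
        _ = e₃ := Real.rpow_one _
    calc (R : ℝ) / e₃ ≤ x ^ (1 / 10 : ℝ) / e₃ := div_le_div_of_nonneg_right hRx10 he₃0.le
      _ ≤ x ^ (1 / 10 : ℝ) / (e₃ : ℝ) ^ (1 / 10 : ℝ) :=
          div_le_div_of_nonneg_left (by positivity) (by positivity) h1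
      _ = (x / e₃) ^ (1 / 10 : ℝ) := by rw [Real.div_rpow hx0.le he₃0.le]
      _ ≤ (2 * (x / e₃)) ^ (1 / 10 : ℝ) := Real.rpow_le_rpow (by positivity) (by linarith [div_pos hx0 he₃0]) (by norm_num)
  have hRb1 : 1 ≤ (R : ℝ) / eB := (one_le_div heB0).2 heBR
  have hRbR : (R : ℝ) / eB ≤ R / e₃ := div_le_div_of_nonneg_left hR0.le he₃0 heB₃
  have hMINOR := hMIN x y e₁ e₂ e₃ eB hx.1 hy4 hylog hα1 he₁ he₂ he₃ heB₁ heB₂ heB₃ heBx hx₁.1 hy8₁ hy6₁ hy200₁ hα₁ hΨ₁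
    hx₂.1 hy8₂ hy6₂ hy200₂ hα₂ hΨ₂ hx₃.1 hy8₃ hy6₃ hy200₃ hα₃ hΨ₃ hy8₃' hα' hy107 N₀ hN1 hN2 σ hσ d₁ d₂ hIc₁ hIc₂
    ((R : ℝ) / e₃) ((R : ℝ) / eB) hRb1 hRbR hRe₃ c₁ c₂ c₃ hp₁ hp₂ hp₃ hc₃ P hP₃ G₀ hG₀ hGM Φ hΦ (Finset.range N₀ \ Maj)
    Finset.sdiff_subset hminor
  clear hMIN hminor hW hF
  -- ### the circle split and the phase convention
  have hsplit := parity_circle_split y hσ d₁ d₂ (by positivity : 0 ≤ x / e₁) (by positivity : 0 ≤ x / e₂)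
    (by positivity : 0 ≤ x / e₃) hN c₁ c₂ c₃ hMajsub
  have hassoc : ∑ r ∈ Maj, classProfileSum (x / e₁) y 2 1 c₁ ((d₁ : ℝ) * r / N₀) *
      classProfileSum (x / e₂) y 2 1 c₂ ((σ : ℝ) * d₂ * r / N₀) * starRingEnd ℂ (classProfileSum (x / e₃) y 1 0 c₃ ((r : ℝ) / N₀)) =
      ∑ r ∈ Maj, classProfileSum (x / e₁) y 2 1 c₁ ((d₁ : ℝ) * ((r : ℝ) / N₀)) *
      classProfileSum (x / e₂) y 2 1 c₂ ((σ : ℝ) * d₂ * ((r : ℝ) / N₀)) *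
        starRingEnd ℂ (classProfileSum (x / e₃) y 1 0 c₃ ((r : ℝ) / N₀)) :=
    Finset.sum_congr rfl fun r _ => by rw [mul_div_assoc, mul_div_assoc]
  rw [hassoc] at hsplit
  -- ### combine
  set COUNT : ℂ := parityTernarySum y σ d₁ d₂ (x / e₁) (x / e₂) (x / e₃) c₁ c₂ c₃ with hCOUNT
  set SS : ℂ := paritySingSeries (saddlePoint x y) σ d₁ d₂ with hSS
  set MC : ℂ := parityModelCount σ d₁ d₂ (x / e₁) (x / e₂) (x / e₃) ((e₁ : ℝ) ^ (-saddlePoint x y) * (x ^ saddlePoint x y * smoothZeta (saddlePoint x y) y /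
            Real.sqrt (2 * Real.pi * saddlePhi₂ (saddlePoint x y) y)))
    ((e₂ : ℝ) ^ (-saddlePoint x y) * (x ^ saddlePoint x y * smoothZeta (saddlePoint x y) y /
            Real.sqrt (2 * Real.pi * saddlePhi₂ (saddlePoint x y) y)))
    ((e₃ : ℝ) ^ (-saddlePoint x y) * (x ^ saddlePoint x y * smoothZeta (saddlePoint x y) y /
            Real.sqrt (2 * Real.pi * saddlePhi₂ (saddlePoint x y) y))) (saddlePoint x y) c₁ c₂ c₃ with hMC
  set SMaj : ℂ := ∑ r ∈ Maj, classProfileSum (x / e₁) y 2 1 c₁ ((d₁ : ℝ) * ((r : ℝ) / N₀)) *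
      classProfileSum (x / e₂) y 2 1 c₂ ((σ : ℝ) * d₂ * ((r : ℝ) / N₀)) *
        starRingEnd ℂ (classProfileSum (x / e₃) y 1 0 c₃ ((r : ℝ) / N₀)) with hSMaj
  set ST : ℂ := ∑ r ∈ Finset.range N₀ \ Maj, classProfileSum (x / e₁) y 2 1 c₁ ((d₁ : ℝ) * r / N₀) *
      classProfileSum (x / e₂) y 2 1 c₂ ((σ : ℝ) * d₂ * r / N₀) *
        starRingEnd ℂ (classProfileSum (x / e₃) y 1 0 c₃ ((r : ℝ) / N₀)) with hST
  set m : ℝ := ((e₁ : ℝ) ^ (-saddlePoint x y) * (x ^ saddlePoint x y * smoothZeta (saddlePoint x y) y /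
            Real.sqrt (2 * Real.pi * saddlePhi₂ (saddlePoint x y) y))) *
      ((e₂ : ℝ) ^ (-saddlePoint x y) * (x ^ saddlePoint x y * smoothZeta (saddlePoint x y) y /
            Real.sqrt (2 * Real.pi * saddlePhi₂ (saddlePoint x y) y))) *
      ((e₃ : ℝ) ^ (-saddlePoint x y) * (x ^ saddlePoint x y * smoothZeta (saddlePoint x y) y /
            Real.sqrt (2 * Real.pi * saddlePhi₂ (saddlePoint x y) y))) with hm
  set Fv : ℝ := (P ^ 3 * H * (331 * η * (28 + 16 * Real.log (2 * eB)) +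
                100 * (eB / (3 * R) + 8 * D * (1 + 2 * eB * (1 + Real.log (2 * x))) / x)) +
              2316 * R * (3 * (11 * P + 1) ^ 2 * Δ * H + 375 * (11 * P + 2) ^ 2 * W * (R : ℝ) ^ 8) +
              48 * D ^ 2 * P ^ 3 * ((R : ℝ) + 1) ^ (-(1 / 6 : ℝ))) with hFv
  set Kv : ℝ := C * Real.log x ^ 24 * eB *
                (P * (C * Real.log (2 * x) ^ 3 * (y : ℝ) ^ (1 / 4000 : ℝ) * ((R : ℝ) / eB) ^ (-(9 / 20 : ℝ)) *
                    (2 * Real.sqrt 5 * Real.sqrt (2 * Real.pi * Φ)) +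
                  (164 * (1 + Real.log (2 * x)) ^ 2 * (y : ℝ) ^ 2 * (2 * x) ^ (9 / 10 : ℝ) + 1) * eB / G₀ +
                  64 * Real.sqrt (2 * Real.pi * Φ) / ((R : ℝ) / eB) ^ 2) +
                8 * Real.sqrt (2 * Real.pi * Φ) * P / ((R : ℝ) / eB) ^ 3) ^ (1 / 2 : ℝ) with hKv
  have hm0 : 0 ≤ m := by
    rw [hm]
    have := smoothZeta_pos (y := y) (saddlePoint_pos hx1 hy2)
    positivity
  have hP0 : 0 ≤ P := (profileNorm_nonneg c₃).trans hP₃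
  have hL0 : 0 ≤ Real.log x := by linarith
  have hlog2x : 0 ≤ Real.log (2 * x) := Real.log_nonneg (by linarith)
  have hKv0 : 0 ≤ Kv := by rw [hKv]; positivity
  clear_value COUNT SS MC SMaj ST m Fv Kv
  have hN0C : ‖(N₀ : ℂ)‖ = N₀ := by simp
  have h1 : ‖(N₀ : ℂ) * (COUNT - SS * MC)‖ ≤ (e₃ : ℝ) * m * Fv + m * Kv := by
    have heq : (N₀ : ℂ) * (COUNT - SS * MC) = (SMaj - (N₀ : ℂ) * SS * MC) + ST := by rw [mul_sub, hsplit]; ring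
    rw [heq]
    exact (norm_add_le _ _).trans (add_le_add hMAJ hMINOR)
  have h2 : (e₃ : ℝ) * m * Fv + m * Kv ≤ (e₃ : ℝ) * m * (Fv + Kv) := by
    have : m * Kv ≤ (e₃ : ℝ) * (m * Kv) := le_mul_of_one_le_left (mul_nonneg hm0 hKv0) he₃1
    linarith
  have hT0 : 0 ≤ (e₃ : ℝ) * m * (Fv + Kv) := (norm_nonneg _).trans (h1.trans h2)
  rw [norm_mul, hN0C] at h1
  calc ‖COUNT - SS * MC‖ ≤ (e₃ : ℝ) * m * (Fv + Kv) / N₀ := by rw [le_div_iff₀ hN0, mul_comm]; exact h1.trans h2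
    _ ≤ (e₃ : ℝ) * m * (Fv + Kv) / x := div_le_div_of_nonneg_left hT0 hx0 hxN.le
    _ = m / (x / e₃) * (Fv + Kv) := by field_simp

end SmoothArcs

end Literature.NumberTheory.Sieve

end
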